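import Mathlib
import Summits.Ventures.PercRepro2.HCov
import Summits.Ventures.PercRepro2.CCTRootEdge
import Summits.Ventures.PercRepro2.CCTAvoidedEdge
import Summits.Ventures.PercRepro2.A3FibreA
import Summits.Ventures.PercRepro2.A3FibreWorlds
import Summits.Ventures.PercRepro2.A3FibreFactors

/-!
# The root-edge closure of (HCOV), part I: the pinned structure at `p[e ↦ 1]`, the gluing identities
and the three signed pieces `g₁`, `df`, `dg` (blind cell PercRepro2, p5 g13; `proofs/P5-ROOTEDGE.md`
§1–§2, S4 §2.4 (n) addendum (vii); part II = `A3RootEdgeMain.lean`)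

Let `e` be an edge between `a₃` and the root `a₁`, `t = p e`, `p₀ = p[e ↦ 0]` (the instance `G − e`),
`p₁ = p[e ↦ 1]` (`e` surely open: `a₃ ∈ C₁`).  The law of total covariance over the status of `e`,
at the FIXED constant `γ = γ_G = γ_{G−e}` (`PD ⊆ {e closed}`), gives the exact cleared identity

  `Q₀·Q₁·Gc(p) = (1 − t)²·Q·Q₁·Gc(p₀) + t(1 − t)·[D₀·Q·Q₀·g₁ + (1 − t)·df·dg]`

(`key_identity`; `Q = P_p(Q)`, `Q₀ = P₀(Q)`, `Q₁ = P₁(Q)`, `D₀ = P₀(PD)`) with three nonnegative pieces: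

* `g₁ = −2[Q₁(P₁(Q,bL,oH) − P₁(Q,bH,oH)) − (P₁(Q,bL) − P₁(Q,bH))·P₁(Q,oH)] ≥ 0` (`g1_nonneg`):
  the (HCOV) functional at `p₁`, where `F = γ − 2·1_{o∈C₂}`, is a BHK 1.3 + 1.4 slack
  (`bhk_same_cluster_events`, `bhk_cross_cluster_avoid` at the pinned weights);
* `df = Q₀·(P₁(Q,bL) − P₁(Q,bH)) − Q₁·(P₀(Q,bL) − P₀(Q,bH)) ≥ 0` (`dfc_nonneg`): opening `e` raises
  `E_ν[σ_b]` — the `bL` half is `CCT.shift_root_edge` (the glued cluster `C₁ ∪ C₃` only grows), the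
  `bH` half is BHK 1.3 at `p₀` after the gluing identity `P₁(Q ∩ {b ∈ C₂}) = P₀(Q ∩ {a₃ ∉ C₂} ∩ {b ∈ C₂})`;
* `dg = D_o⁰·Q₀·Q₁ − 2·P₁(Q,oH)·D₀·Q₀ − DEF⁰·Q₁ ≥ 0` (`dgc_nonneg`): opening `e` raises `E_ν[F]`;
  through the margin identity this is `2(D₀ + P₀(T′))(P₀(PD,oL)P₀(T) − D₀P₀(T,oL)) +
  2P₀(T)(P₀(PD,oH)P₀(T′) − D₀P₀(T′,oH)) ≥ 0` — the cell's margin lemma `ToL_mul_D_le` and its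
  root-swap mirror (`PDEvent_swap`), exactly as in `A3Fibre.factor_o`.

Hence **`HCov_of_update_zero`**: `HCov p[e ↦ 0] → HCov p` — (HCOV) is closed under adding an edge
between `a₃` and a root; by induction the crux reduces to graphs in which `a₃` has no root edge.
The degenerate cases: `Q₀ = 0` forces `D = D_o = 0` at `p` and `Gc = 0` (`Gc_eq_zero_of_D_Do`);
`Q₁ = 0` kills every `p₁`-atom and `Gc(p) = (1 − t)³·Gc(p₀)`.
-/

namespace Summit.Ventures.PercRepro2

open UnionCluster

namespace CovForm

namespace RootEdge

open CCT A3Fibre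

section Structure

variable {V : Type*} {E : Type*} [Fintype V] [DecidableEq V] [Fintype E] [DecidableEq E]
  {R : Type*} [Field R] [LinearOrder R] [IsStrictOrderedRing R]

variable {ends : E → Sym2 V} {e : E} {a₁ a₃ : V}

omit [Fintype V] [DecidableEq V] [Fintype E] in
/-- With `e = {a₁, a₃}` open, `a₁ ↔ a₃`. -/
lemma conn_update_true (hends : ends e = s(a₁, a₃)) (ω : Config E) :
    Conn ends (Function.update ω e true) a₁ a₃ :=
  conn_of_openAdj ⟨e, by simp, hends⟩

omit [Fintype V] [DecidableEq V] [LinearOrder R] [IsStrictOrderedRing R] in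
/-- At `p[e ↦ 1]` the world `PD` is null (`a₃ ∈ C₁`). -/
lemma prob_one_PD_inter (p : E → R) (hends : ends e = s(a₁, a₃)) (a₂ : V) (X : Set (Config E)) :
    prob (Function.update p e 1) (PDEvent ends a₁ a₂ a₃ ∩ X) = 0 := by
  rw [prob_update_one_eq]
  have h : {ω : Config E | Function.update ω e true ∈ PDEvent ends a₁ a₂ a₃ ∩ X} = ∅ := by
    ext ω
    simp only [Set.mem_setOf_eq, Set.mem_empty_iff_false, iff_false, Set.mem_inter_iff, not_and]
    intro hPD _
    have h13 := conn_update_true hends ω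
    simp only [PDEvent, Dtilde, Set.mem_inter_iff, Set.mem_compl_iff, mem_inU] at hPD
    exact hPD.2 (Or.inl (conn_symm h13))
  rw [h, prob_empty]

omit [Fintype V] [DecidableEq V] [LinearOrder R] [IsStrictOrderedRing R] in
/-- At `p[e ↦ 1]` the world `T = {a₃ ∈ C₂}` is null. -/
lemma prob_one_T_inter (p : E → R) (hends : ends e = s(a₁, a₃)) (a₂ : V) (X : Set (Config E)) :
    prob (Function.update p e 1) (TEvent ends a₁ a₂ a₃ ∩ X) = 0 := by
  rw [prob_update_one_eq]
  have h : {ω : Config E | Function.update ω e true ∈ TEvent ends a₁ a₂ a₃ ∩ X} = ∅ := by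
    ext ω
    simp only [Set.mem_setOf_eq, Set.mem_empty_iff_false, iff_false, Set.mem_inter_iff, not_and]
    intro hT _
    have h13 := conn_update_true hends ω
    simp only [TEvent, Set.mem_inter_iff, Set.mem_compl_iff, mem_connEvent] at hT
    exact hT.1 (conn_trans hT.2 (conn_symm h13))
  rw [h, prob_empty]

omit [Fintype V] [DecidableEq V] [LinearOrder R] [IsStrictOrderedRing R] in
/-- At `p[e ↦ 1]` the world `T′ = {a₃ ∈ C₁}` is all of `Q`. -/
lemma prob_one_T'_inter (p : E → R) (hends : ends e = s(a₁, a₃)) (a₂ : V) (X : Set (Config E)) :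
    prob (Function.update p e 1) (TEvent ends a₂ a₁ a₃ ∩ X) =
      prob (Function.update p e 1) (avoidAll ends a₂ {a₁} ∩ X) := by
  rw [prob_update_one_eq, prob_update_one_eq]
  congr 1
  ext ω
  have h13 := conn_update_true hends ω
  simp only [Set.mem_setOf_eq, Set.mem_inter_iff, TEvent, Set.mem_compl_iff, mem_connEvent,
    mem_avoidAll, Finset.mem_singleton, forall_eq]
  constructor
  · rintro ⟨⟨h1, _⟩, hX⟩
    exact ⟨fun hc => h1 (conn_symm hc), hX⟩
  · rintro ⟨h1, hX⟩
    exact ⟨⟨fun hc => h1 (conn_symm hc), h13⟩, hX⟩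

omit [Fintype V] [DecidableEq V] [LinearOrder R] [IsStrictOrderedRing R] in
/-- At `p[e ↦ 1]`, `P(PD) = 0` (the bare version of `prob_one_PD_inter`). -/
lemma prob_one_PD (p : E → R) (hends : ends e = s(a₁, a₃)) (a₂ : V) :
    prob (Function.update p e 1) (PDEvent ends a₁ a₂ a₃) = 0 := by
  have h := prob_one_PD_inter p hends a₂ Set.univ
  simpa only [Set.inter_univ] using h

omit [Fintype V] [DecidableEq V] [LinearOrder R] [IsStrictOrderedRing R] in
/-- At `p[e ↦ 1]`, `P(T) = 0` (the bare version of `prob_one_T_inter`). -/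
lemma prob_one_T (p : E → R) (hends : ends e = s(a₁, a₃)) (a₂ : V) :
    prob (Function.update p e 1) (TEvent ends a₁ a₂ a₃) = 0 := by
  have h := prob_one_T_inter p hends a₂ Set.univ
  simpa only [Set.inter_univ] using h

omit [Fintype V] [DecidableEq V] [LinearOrder R] [IsStrictOrderedRing R] in
/-- At `p[e ↦ 1]`, `P(T′) = P(Q)` (the bare version of `prob_one_T'_inter`). -/
lemma prob_one_T' (p : E → R) (hends : ends e = s(a₁, a₃)) (a₂ : V) :
    prob (Function.update p e 1) (TEvent ends a₂ a₁ a₃) =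
      prob (Function.update p e 1) (avoidAll ends a₂ {a₁}) := by
  have h := prob_one_T'_inter p hends a₂ Set.univ
  simpa only [Set.inter_univ] using h

/-! ### The gluing identities: `p₁`-masses of `C₂`-events as `p₀`-masses -/

omit [Fintype V] [DecidableEq V] [Fintype E] [LinearOrder R] [IsStrictOrderedRing R] in
/-- `ω[e ↦ open] ∈ Q ↔ ω[e ↦ closed] ∈ Q ∧ a₃ ∉ C₂(ω[e ↦ closed])`. -/
lemma update_true_mem_Q_iff (hends : ends e = s(a₁, a₃)) (a₂ : V) (ω : Config E) :
    Function.update ω e true ∈ avoidAll ends a₂ {a₁} ↔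
      Function.update ω e false ∈ avoidAll ends a₂ {a₁} ∧
        ¬ Conn ends (Function.update ω e false) a₂ a₃ := by
  rw [avoidAll_symm ends a₁ a₂, update_true_mem_avoidAll_iff hends ω {a₂}]
  simp only [mem_clusterSetInEvent, mem_clusterSet, Set.mem_setOf_eq, Finset.mem_singleton,
    exists_eq_left]

omit [Fintype V] [DecidableEq V] [Fintype E] [LinearOrder R] [IsStrictOrderedRing R] in
/-- On `Q ∩ {a₃ ∉ C₂}` the cluster of `a₂` does not see `e`. -/
lemma cluster_a2_update (hends : ends e = s(a₁, a₃)) (a₂ : V) (ω : Config E)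
    (hQ : Function.update ω e false ∈ avoidAll ends a₂ {a₁})
    (h3 : ¬ Conn ends (Function.update ω e false) a₂ a₃) :
    cluster ends (Function.update ω e true) a₂ = cluster ends (Function.update ω e false) a₂ := by
  refine cluster_update_true_eq_of_not_touch ends hends ω a₂ ?_ ?_
  · rw [mem_cluster]
    simp only [mem_avoidAll, Finset.mem_singleton, forall_eq] at hQ
    exact hQ
  · rw [mem_cluster]
    exact h3

omit [Fintype V] [DecidableEq V] [LinearOrder R] [IsStrictOrderedRing R] in
/-- **Gluing**: `P₁(Q ∩ {v ∈ C₂}) = P₀((Q ∩ {v ∈ C₂}) ∩ {a₃ ∉ C₂})`. -/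
lemma prob_one_Q_conn (p : E → R) (hends : ends e = s(a₁, a₃)) (a₂ v : V) :
    prob (Function.update p e 1) (avoidAll ends a₂ {a₁} ∩ connEvent ends a₂ v) =
      prob (Function.update p e 0)
        (avoidAll ends a₂ {a₁} ∩ connEvent ends a₂ v ∩ (connEvent ends a₂ a₃)ᶜ) := by
  rw [prob_update_one_eq, prob_update_zero_eq]
  congr 1
  ext ω
  simp only [Set.mem_setOf_eq, Set.mem_inter_iff, Set.mem_compl_iff, mem_connEvent,
    update_true_mem_Q_iff hends a₂ ω]
  constructor
  · rintro ⟨⟨hQ, h3⟩, hv⟩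
    refine ⟨⟨hQ, ?_⟩, h3⟩
    have hc := cluster_a2_update hends a₂ ω hQ h3
    rw [← mem_cluster, ← hc, mem_cluster]
    exact hv
  · rintro ⟨⟨hQ, hv⟩, h3⟩
    refine ⟨⟨hQ, h3⟩, ?_⟩
    have hc := cluster_a2_update hends a₂ ω hQ h3
    rw [← mem_cluster, hc, mem_cluster]
    exact hv

omit [Fintype V] [DecidableEq V] [LinearOrder R] [IsStrictOrderedRing R] in
/-- **Gluing, bare**: `P₁(Q) = P₀(Q ∩ {a₃ ∉ C₂})`. -/
lemma prob_one_Q (p : E → R) (hends : ends e = s(a₁, a₃)) (a₂ : V) :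
    prob (Function.update p e 1) (avoidAll ends a₂ {a₁}) =
      prob (Function.update p e 0) (avoidAll ends a₂ {a₁} ∩ (connEvent ends a₂ a₃)ᶜ) := by
  rw [prob_update_one_eq, prob_update_zero_eq]
  congr 1
  ext ω
  simp only [Set.mem_setOf_eq, Set.mem_inter_iff, Set.mem_compl_iff, mem_connEvent,
    update_true_mem_Q_iff hends a₂ ω]

end Structure

/-! ### The three signed pieces -/

section Signs

variable {V : Type*} {E : Type*} [Fintype V] [DecidableEq V] [Fintype E] [DecidableEq E]
  {R : Type*} [Field R] [LinearOrder R] [IsStrictOrderedRing R]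

/-- **`g₁ ≥ 0`**: at any weight vector, `−2[Q(P(Q,bL,oH) − P(Q,bH,oH)) − (P(Q,bL) − P(Q,bH))P(Q,oH)] ≥ 0`
— BHK 1.3 (`b ∈ C₂`, `o ∈ C₂`) and BHK 1.4 (`b ∈ C₁`, `o ∈ C₂`) under `Q`. -/
lemma g1_nonneg (p : E → R) (hp : IsProbVec p) (ends : E → Sym2 V) (o a₁ a₂ b : V) :
    0 ≤ -2 * (prob p (avoidAll ends a₂ {a₁}) *
        (prob p (avoidAll ends a₂ {a₁} ∩ (connEvent ends a₂ o ∩ connEvent ends a₁ b)) -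
          prob p (avoidAll ends a₂ {a₁} ∩ (connEvent ends a₂ o ∩ connEvent ends a₂ b))) -
      (prob p (avoidAll ends a₂ {a₁} ∩ connEvent ends a₁ b) -
          prob p (avoidAll ends a₂ {a₁} ∩ connEvent ends a₂ b)) *
        prob p (avoidAll ends a₂ {a₁} ∩ connEvent ends a₂ o)) := by
  have h13 := bhk_same_cluster_events p hp ends a₂ a₁ (isUpperSet_mem_setOf o)
    (isUpperSet_mem_setOf b)
  rw [← connEvent_eq_clusterInEvent, ← connEvent_eq_clusterInEvent,
    ← avoidAll_eq_compl ends a₁ a₂] at h13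
  have h14 := bhk_cross_cluster_avoid p hp ends a₂ a₁ (Finset.mem_singleton_self a₁)
    (isUpperSet_mem_setOf o) (isUpperSet_mem_setOf b)
  rw [← connEvent_eq_clusterInEvent, ← connEvent_eq_clusterInEvent] at h14
  have e1 : connEvent ends a₂ o ∩ connEvent ends a₂ b ∩ avoidAll ends a₂ {a₁} =
      avoidAll ends a₂ {a₁} ∩ (connEvent ends a₂ o ∩ connEvent ends a₂ b) := by
    ext ω; simp only [Set.mem_inter_iff]; tauto
  have e2 : connEvent ends a₂ o ∩ avoidAll ends a₂ {a₁} =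
      avoidAll ends a₂ {a₁} ∩ connEvent ends a₂ o := Set.inter_comm _ _
  have e3 : connEvent ends a₂ b ∩ avoidAll ends a₂ {a₁} =
      avoidAll ends a₂ {a₁} ∩ connEvent ends a₂ b := Set.inter_comm _ _
  have e4 : connEvent ends a₂ o ∩ connEvent ends a₁ b ∩ avoidAll ends a₂ {a₁} =
      avoidAll ends a₂ {a₁} ∩ (connEvent ends a₂ o ∩ connEvent ends a₁ b) := by
    ext ω; simp only [Set.mem_inter_iff]; tauto
  have e5 : connEvent ends a₁ b ∩ avoidAll ends a₂ {a₁} =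
      avoidAll ends a₂ {a₁} ∩ connEvent ends a₁ b := Set.inter_comm _ _
  rw [e1, e2, e3] at h13
  rw [e2, e4, e5] at h14
  nlinarith [h13, h14]

/-- **`df ≥ 0`**: `Q₀·(P₁(Q,bL) − P₁(Q,bH)) ≥ Q₁·(P₀(Q,bL) − P₀(Q,bH))` — opening the root edge
raises `E_ν[σ_b]` (`shift_root_edge` for the `bL` half; BHK 1.3 at `p₀` after the gluing for `bH`). -/
lemma dfc_nonneg (p : E → R) (hp : IsProbVec p) (ends : E → Sym2 V) (a₁ a₂ a₃ b : V) (e : E)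
    (hends : ends e = s(a₁, a₃)) :
    0 ≤ prob (Function.update p e 0) (avoidAll ends a₂ {a₁}) *
        (prob (Function.update p e 1) (avoidAll ends a₂ {a₁} ∩ connEvent ends a₁ b) -
          prob (Function.update p e 1) (avoidAll ends a₂ {a₁} ∩ connEvent ends a₂ b)) -
      prob (Function.update p e 1) (avoidAll ends a₂ {a₁}) *
        (prob (Function.update p e 0) (avoidAll ends a₂ {a₁} ∩ connEvent ends a₁ b) -
          prob (Function.update p e 0) (avoidAll ends a₂ {a₁} ∩ connEvent ends a₂ b)) := by
  have hp₀ : IsProbVec (Function.update p e 0) := hp.update e le_rfl zero_le_one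
  -- the `bL` half: the shift lemma at the root edge
  have hL := shift_root_edge p ends hp hends {a₂} (isUpperSet_mem_setOf b)
  rw [← connEvent_eq_clusterInEvent, ← avoidAll_symm ends a₁ a₂] at hL
  -- the `bH` half: gluing + BHK 1.3 at `p₀`
  have hg := prob_one_Q_conn p hends a₂ b
  have hQ1 := prob_one_Q p hends a₂
  have h13 := bhk_same_cluster_events (Function.update p e 0) hp₀ ends a₂ a₁
    (isUpperSet_mem_setOf b) (isUpperSet_mem_setOf a₃)
  rw [← connEvent_eq_clusterInEvent, ← connEvent_eq_clusterInEvent,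
    ← avoidAll_eq_compl ends a₁ a₂] at h13
  have e1 : connEvent ends a₂ b ∩ avoidAll ends a₂ {a₁} =
      avoidAll ends a₂ {a₁} ∩ connEvent ends a₂ b := Set.inter_comm _ _
  have e2 : connEvent ends a₂ a₃ ∩ avoidAll ends a₂ {a₁} =
      avoidAll ends a₂ {a₁} ∩ connEvent ends a₂ a₃ := Set.inter_comm _ _
  have e3 : connEvent ends a₂ b ∩ connEvent ends a₂ a₃ ∩ avoidAll ends a₂ {a₁} =
      avoidAll ends a₂ {a₁} ∩ connEvent ends a₂ b ∩ connEvent ends a₂ a₃ := by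
    ext ω; simp only [Set.mem_inter_iff]; tauto
  rw [e1, e2, e3] at h13
  have s1 := prob_inter_add_prob_inter_compl (Function.update p e 0)
    (avoidAll ends a₂ {a₁} ∩ connEvent ends a₂ b) (connEvent ends a₂ a₃)
  have s2 := prob_inter_add_prob_inter_compl (Function.update p e 0)
    (avoidAll ends a₂ {a₁}) (connEvent ends a₂ a₃)
  have hH : prob (Function.update p e 0) (avoidAll ends a₂ {a₁}) *
      prob (Function.update p e 1) (avoidAll ends a₂ {a₁} ∩ connEvent ends a₂ b) ≤
      prob (Function.update p e 1) (avoidAll ends a₂ {a₁}) *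
      prob (Function.update p e 0) (avoidAll ends a₂ {a₁} ∩ connEvent ends a₂ b) := by
    rw [hg, hQ1]
    have hC : prob (Function.update p e 0)
        (avoidAll ends a₂ {a₁} ∩ connEvent ends a₂ b ∩ (connEvent ends a₂ a₃)ᶜ) =
        prob (Function.update p e 0) (avoidAll ends a₂ {a₁} ∩ connEvent ends a₂ b) -
          prob (Function.update p e 0)
            (avoidAll ends a₂ {a₁} ∩ connEvent ends a₂ b ∩ connEvent ends a₂ a₃) := by
      linarith [s1]
    have hE : prob (Function.update p e 0) (avoidAll ends a₂ {a₁} ∩ (connEvent ends a₂ a₃)ᶜ) =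
        prob (Function.update p e 0) (avoidAll ends a₂ {a₁}) -
          prob (Function.update p e 0) (avoidAll ends a₂ {a₁} ∩ connEvent ends a₂ a₃) := by
      linarith [s2]
    rw [hC, hE]
    nlinarith [h13]
  nlinarith [hL, hH]

/-- **`dg ≥ 0`**: `D_o⁰·Q₀·Q₁ − 2·P₁(Q,oH)·D₀·Q₀ − DEF⁰·Q₁ ≥ 0` — opening the root edge raises
`E_ν[F]`; through the margin identity this is the two margin lemmas. -/
lemma dgc_nonneg (p : E → R) (hp : IsProbVec p) (ends : E → Sym2 V) (o a₁ a₂ a₃ : V) (e : E)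
    (hends : ends e = s(a₁, a₃)) :
    0 ≤ Do (Function.update p e 0) ends o a₁ a₂ a₃ * prob (Function.update p e 0) (avoidAll ends a₂ {a₁}) *
          prob (Function.update p e 1) (avoidAll ends a₂ {a₁}) -
        2 * prob (Function.update p e 1) (avoidAll ends a₂ {a₁} ∩ connEvent ends a₂ o) *
          prob (Function.update p e 0) (PDEvent ends a₁ a₂ a₃) *
          prob (Function.update p e 0) (avoidAll ends a₂ {a₁}) -
        DEF (Function.update p e 0) ends o a₁ a₂ a₃ * prob (Function.update p e 1) (avoidAll ends a₂ {a₁}) := by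
  have hp₀ : IsProbVec (Function.update p e 0) := hp.update e le_rfl zero_le_one
  -- `Q ∩ {a₃ ∈ C₂} = T`
  have hT : avoidAll ends a₂ {a₁} ∩ connEvent ends a₂ a₃ = TEvent ends a₁ a₂ a₃ := by
    rw [TEvent, avoidAll_eq_compl]
  have hToH : avoidAll ends a₂ {a₁} ∩ connEvent ends a₂ o ∩ connEvent ends a₂ a₃ =
      TEvent ends a₁ a₂ a₃ ∩ connEvent ends a₂ o := by
    rw [TEvent, avoidAll_eq_compl]; ext ω; simp only [Set.mem_inter_iff]; tauto
  -- `Q₁ = D₀ + P₀(T′)`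
  have hQ1 := prob_one_Q p hends a₂
  have s2 := prob_inter_add_prob_inter_compl (Function.update p e 0) (avoidAll ends a₂ {a₁})
    (connEvent ends a₂ a₃)
  have hsplit := Qsplit (Function.update p e 0) ends a₁ a₂ a₃ Set.univ
  simp only [Set.inter_univ] at hsplit
  rw [hT] at s2
  have hE : prob (Function.update p e 0) (avoidAll ends a₂ {a₁} ∩ (connEvent ends a₂ a₃)ᶜ) =
      prob (Function.update p e 0) (PDEvent ends a₁ a₂ a₃) +
        prob (Function.update p e 0) (TEvent ends a₂ a₁ a₃) := by
    linarith [s2, hsplit]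
  -- `P₁(Q, oH) = P₀(PD, oH) + P₀(T′, oH)`
  have hoH := prob_one_Q_conn p hends a₂ o
  have s1 := prob_inter_add_prob_inter_compl (Function.update p e 0)
    (avoidAll ends a₂ {a₁} ∩ connEvent ends a₂ o) (connEvent ends a₂ a₃)
  have hsplito := Qsplit (Function.update p e 0) ends a₁ a₂ a₃ (connEvent ends a₂ o)
  rw [hToH] at s1
  have hO : prob (Function.update p e 0)
      (avoidAll ends a₂ {a₁} ∩ connEvent ends a₂ o ∩ (connEvent ends a₂ a₃)ᶜ) =
      prob (Function.update p e 0) (PDEvent ends a₁ a₂ a₃ ∩ connEvent ends a₂ o) +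
        prob (Function.update p e 0) (TEvent ends a₂ a₁ a₃ ∩ connEvent ends a₂ o) := by
    linarith [s1, hsplito]
  -- the margin identity and the two margin lemmas at `p₀`
  have hm := margin_identity (Function.update p e 0) ends o a₁ a₂ a₃
  have hDEF : DEF (Function.update p e 0) ends o a₁ a₂ a₃ =
      Do (Function.update p e 0) ends o a₁ a₂ a₃ *
          prob (Function.update p e 0) (avoidAll ends a₂ {a₁}) -
        marginC (Function.update p e 0) ends o a₁ a₂ a₃ := by
    unfold marginC; ring
  have M1 := ToL_mul_D_le (Function.update p e 0) hp₀ ends o a₁ a₂ a₃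
  have M2 := ToL_mul_D_le (Function.update p e 0) hp₀ ends o a₂ a₁ a₃
  rw [PDEvent_swap] at M2
  have hT0 := prob_nonneg hp₀ (TEvent ends a₁ a₂ a₃)
  have hT'0 := prob_nonneg hp₀ (TEvent ends a₂ a₁ a₃)
  have hD0 := prob_nonneg hp₀ (PDEvent ends a₁ a₂ a₃)
  rw [hQ1, hoH, hDEF, hm, hO, hE, hsplit]
  unfold Do
  nlinarith [mul_nonneg (add_nonneg hD0 hT'0) (sub_nonneg.2 M1), mul_nonneg hT0 (sub_nonneg.2 M2)]

end Signs

end RootEdge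

end CovForm

end Summit.Ventures.PercRepro2
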